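import Mathlib
import Literature.MathematicalPhysics.QuantumFieldTheory.Balaban1983to89.B5SmoothPartition
import Literature.MathematicalPhysics.QuantumFieldTheory.Balaban1983to89.B13PerturbativeStep
import Summits.QuantumFields.BalabanUV.Beta.UnitLatticeOmegaBudgets

/-!
# `Summit.QuantumFields.BalabanUV.Beta.UnitLatticeTorusPartition` — THE TORUS-PERIODIC TWIN of `UnitLatticePartition` ∕
# `UnitLatticeTubeCount.packing_comap` ∕ `UnitLatticeProfiles`: for unit-lattice sites mapped into the discrete torus
# `Π_i ℤ∕N_iℤ` (b05's carrier `B5TorusCover.UT N`, sup circular distance), the PARTITION binders of the Ω hand-off are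
# b05's smooth partition `B5SmoothPartition.hSU` (Σ_b h_b² = 1 EVERYWHERE — no «sites inside the box» condition),
# the decoration CELLS are the `M_d`-cubes of the torus with packing `2^ν`, and the two lattice PROFILES are volume-free
# numbers (b04's `B4Sect5Torus.torusSum_le`)

HONEST FRAMING (page 1 of everything in this cell).  Discharging `FlowStep.BetaPertH` would make Bałaban's ultraviolet
stability UNCONDITIONAL — a constructive-QFT result; NOT the continuum limit, NOT the Clay problem.  This module
discharges nothing of `BetaPertH`; [folklore] lattice geometry, kernel-checked (unit `b2b-balaban-beta-d4-p3`, road P3,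
gen 6; the row-D4 owner's (I3) leaf table, NOTE-I3 §3 row (c): «Bałaban's `T_η^{(k)}` is a torus: the periodic twin»).
WHAT IT IS: the geometric binders `hsum`, `hsupp`, `habs`, `hLip`, `hN`, `hdiam`, `hpack` and the profiles `L`, `L₁` of
`UnitLatticeOmegaBudgets.rowData_decFamilyΩ_pieceMaj` ∕ `UnitLatticeOmegaLocal.nearLocal_of_pieceMaj` DISCHARGED for sites
`e : Y → UT N` on the torus, from the TREE'S OWN torus data — nothing new is modelled: partition = b05 `hSU` (support radius
`M₀`, Lipschitz `4ν∕M₀`; `M₀ ∣ N_i`, `2M₀ ≤ N_i`), distance = b05's `dist` on `UT N` (= b04 `tdist`), the same objects co-owner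
d4-p2's `CovariantTowerWRS.dTorus`∕`hTorus` wrap.  Nothing of Bałaban's operators is instantiated.  NOT summit progress.
HONEST DEPENDENCY: continuum YM on T⁴ ⇐ BetaPertH ∧ nine spine estimates (0/9 proved); BetaPertH ⇐
(D1) ∧ (D4) ∧ CAP+tail; G-an2-4 gates asym, D1 and NE2/3/4.

CITATION (locator only; nothing printed is used as a hypothesis).  [B5] = T. Bałaban, *Propagators and renormalization
transformations for lattice gauge theories. I*, Commun. Math. Phys. **95**, 17–40 (1984) [Balaban1984PropagatorsI], (1.118)
p. 36 (the cubes `□_z`, `Σ_z h_z² = 1`); [II] = T. Bałaban, *Renormalization group approach to lattice gauge field theories.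
II*, Commun. Math. Phys. **116**, 1–22 (1988) [Balaban1988RG2Cluster], p. 3 (cubes Δ of the torus `T_η`), p. 5 (1.11) (the 2⁴).

CONTENTS (0 sorry).  §1 `tdistOn e` (pull-back of the torus distance; `WeightHyp`, symmetry).  §2 THE PARTITION BINDERS
`hTor`∕`ETor`: `hTor_sq_sum` (Σ_b h_b(y)² = 1 for EVERY site), `hTor_supp`, `abs_hTor_le`, `hTor_lipschitz'` (modulus
`M₀∕(4ν)`), **`card_ETor_filter_le`** (overlap `≤ 2^ν`, SHARP — per axis exactly two centres see a residue,
`B5SmoothPartition.cdist_two_term`), `diam_ETor_le` (`≤ 2M₀`).  §3 THE CELLS `tcellAt M_d e` (coordinatewise `⌊·∕M_d⌋` of the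
residue, values in `ℤ^ν` — the SAME cell type as the box version) and **`packing_torus`** (every ball of radius `R`,
`2R ≤ M_d`, `M_d ∣ N_i`, meets `≤ 2^ν` cells — the wrap-around handled through centred representatives).  §4 THE PROFILES for
injective sites: **`tprofile_zero_le`** (`Σ_j e^{−a·d} ≤ (2(1 − e^{−a∕ν})⁻¹)^ν` — the SAME closed form as the box's
`profile_zero_le`, by b04 `torusSum_le`), **`tprofile_one_le`**.  §5 non-vacuity.
NOT HERE: the Ω-layer ENDs on the torus (sibling `UnitLatticeOmegaTorus`); anything about Bałaban's operators.
-/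

open scoped BigOperators
open Finset Real

namespace Summit.QuantumFields.BalabanUV.Beta.UnitLatticeTorusPartition

open Literature.MathematicalPhysics.QuantumFieldTheory.Balaban1983to89
open B4TorusKernel.MultiPeriod (circAbs centre circAbs_nonneg abs_add_mul_centre circAbs_le_abs)
open B4Sect5Torus (TSite ccoord tdist circAbs_neg circAbs_le_tdist torusSum_le)
open B5TorusCover (UT Ctr ctr ctrU nC crep abs_crep crep_emod)
open B5TorusPartition (cdist cdist_nonneg ccoord_ctr_eq)
open B5SmoothPartition (hSU sum_hSU_sq hSU_lipschitz hSU_mem_Icc hS_eq_zero_of_le cdist_two_term)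
open B13PerturbativeStep (WeightHyp)
open Summit.QuantumFields.BalabanUV.Beta.UnitLatticeOmegaBudgets (le_exp_mul_div)

noncomputable section

variable {ν : ℕ} {N : Fin ν → ℕ} [∀ i, NeZero (N i)] {Y : Type*} [Fintype Y] [DecidableEq Y]

/-! ## §1 The torus distance pulled back along the sites -/

/-- The pseudo-metric on sites `e : Y → UT N`: the sup circular distance of their images. [folklore] -/
def tdistOn (e : Y → UT N) (y y' : Y) : ℝ := dist (e y) (e y')

omit [Fintype Y] [DecidableEq Y] in
/-- Unfolding. [folklore] -/
theorem tdistOn_apply (e : Y → UT N) (y y' : Y) : tdistOn e y y' = dist (e y) (e y') := rfl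

omit [Fintype Y] [DecidableEq Y] in
/-- Symmetry (`hds` of `UnitLatticeOmegaLocal.nearLocal_of_pieceMaj`). [folklore] -/
theorem tdistOn_comm (e : Y → UT N) (y y' : Y) : tdistOn e y y' = tdistOn e y' y := dist_comm _ _

omit [Fintype Y] [DecidableEq Y] in
/-- `0 ≤ tdistOn`. [folklore] -/
theorem tdistOn_nonneg (e : Y → UT N) (y y' : Y) : 0 ≤ tdistOn e y y' := dist_nonneg

omit [Fintype Y] [DecidableEq Y] in
/-- `tdistOn e` is an admissible weight for every `κ ≥ 0`. [folklore] -/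
theorem weightHyp_tdistOn (e : Y → UT N) {κ : ℝ} (hκ : 0 ≤ κ) : WeightHyp κ (tdistOn e) where
  κ_nonneg := hκ
  zero y := dist_self (e y)
  nonneg _ _ := dist_nonneg
  tri a b c := dist_triangle (e a) (e b) (e c)

omit [Fintype Y] [DecidableEq Y] in
/-- Each circular coordinate distance is at most `tdistOn`. [folklore] -/
theorem circAbs_le_tdistOn (e : Y → UT N) (y y' : Y) (i : Fin ν) :
    (circAbs (N i) (((UT.toSite N (e y) i).val : ℤ) - ((UT.toSite N (e y') i).val : ℤ)) : ℝ) ≤ tdistOn e y y' :=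
  circAbs_le_tdist (UT.one_le N) _ _ i

/-! ## §2 The partition binders: b05's smooth partition read on the sites -/

section Partition

variable {M₀ : ℕ}

/-- THE PARTITION FUNCTIONS on the sites: `h_b(y) = hSU_b(e y)` (b05's smooth partition at scale `M₀`, centres
`b : Ctr N M₀`). [folklore] -/
def hTor (M₀ : ℕ) (e : Y → UT N) (b : Ctr N M₀) (y : Y) : ℝ := hSU N M₀ b (e y)

/-- THE CUBE NEIGHBOURHOODS `□̃_b`: sites strictly within torus distance `M₀` of the centre `b`. [folklore] -/
def ETor (M₀ : ℕ) (e : Y → UT N) (b : Ctr N M₀) : Finset Y :=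
  Finset.univ.filter fun y => dist (e y) (ctrU N M₀ b) < M₀

omit [DecidableEq Y] in
/-- Membership in `ETor`. [folklore] -/
theorem mem_ETor (e : Y → UT N) (b : Ctr N M₀) (y : Y) : y ∈ ETor M₀ e b ↔ dist (e y) (ctrU N M₀ b) < M₀ := by
  simp [ETor]

omit [∀ i, NeZero (N i)] [Fintype Y] [DecidableEq Y] in
/-- **`hsum`**: `Σ_b h_b(y)² = 1` for EVERY site (no boundary condition on the torus; `M₀ ∣ N_i`, `2M₀ ≤ N_i`).
[cite: Balaban1984PropagatorsI, (1.118) p.36] -/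
theorem hTor_sq_sum (hM₀ : 1 ≤ M₀) (hdiv : ∀ i, M₀ ∣ N i) (h2N : ∀ i, 2 * M₀ ≤ N i) (e : Y → UT N) (y : Y) :
    ∑ b : Ctr N M₀, hTor M₀ e b y ^ 2 = 1 :=
  sum_hSU_sq N hM₀ hdiv h2N (e y)

omit [DecidableEq Y] in
/-- **`hsupp`**: `h_b(y) = 0` off `□̃_b`. [folklore] -/
theorem hTor_supp (hM₀ : 1 ≤ M₀) (e : Y → UT N) (b : Ctr N M₀) (y : Y) (hy : y ∉ ETor M₀ e b) :
    hTor M₀ e b y = 0 := by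
  rw [mem_ETor, not_lt] at hy
  exact hS_eq_zero_of_le (UT.one_le N) hM₀ hy

omit [Fintype Y] [DecidableEq Y] in
/-- **`habs`**: `|h_b(y)| ≤ 1`. [folklore] -/
theorem abs_hTor_le (M₀ : ℕ) (e : Y → UT N) (b : Ctr N M₀) (y : Y) : |hTor M₀ e b y| ≤ 1 := by
  obtain ⟨h0, h1⟩ := hSU_mem_Icc N M₀ b (e y)
  rw [hTor, abs_of_nonneg h0]
  exact h1

omit [Fintype Y] [DecidableEq Y] in
/-- **`hLip`** (raw form): `|h_b(y) − h_b(y′)| ≤ (4ν∕M₀)·tdistOn e y y′`. [folklore] -/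
theorem hTor_lipschitz (hM₀ : 1 ≤ M₀) (e : Y → UT N) (b : Ctr N M₀) (y y' : Y) :
    |hTor M₀ e b y - hTor M₀ e b y'| ≤ 4 * ν / M₀ * tdistOn e y y' :=
  hSU_lipschitz N hM₀ b (e y) (e y')

omit [Fintype Y] [DecidableEq Y] in
/-- **`hLip`** in the spine's letters: `|h_b(y) − h_b(y′)| ≤ tdistOn e y y′ ∕ M_eff` with `M_eff = M₀∕(4ν)` (`ν ≥ 1`).
[folklore] -/
theorem hTor_lipschitz' (hM₀ : 1 ≤ M₀) (hν : 0 < ν) (e : Y → UT N) (b : Ctr N M₀) (y y' : Y) :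
    |hTor M₀ e b y - hTor M₀ e b y'| ≤ tdistOn e y y' / ((M₀ : ℝ) / (4 * ν)) := by
  have hν' : (0 : ℝ) < ν := by exact_mod_cast hν
  have hM' : (0 : ℝ) < M₀ := by exact_mod_cast hM₀
  calc |hTor M₀ e b y - hTor M₀ e b y'| ≤ 4 * ν / M₀ * tdistOn e y y' := hTor_lipschitz hM₀ e b y y'
    _ = tdistOn e y y' / ((M₀ : ℝ) / (4 * ν)) := by field_simp

/-- **`hN`, OVERLAP `≤ 2^ν` (sharp)**: every site lies in at most `2^ν` cube neighbourhoods — per axis exactly two centres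
are strictly within `M₀` of a residue (`cdist_two_term`; `M₀ ∣ N_i`, `2M₀ ≤ N_i`). [cite: Balaban1988RG2Cluster, (1.11) p.5] -/
theorem card_ETor_filter_le (hM₀ : 1 ≤ M₀) (hdiv : ∀ i, M₀ ∣ N i) (h2N : ∀ i, 2 * M₀ ≤ N i) (e : Y → UT N)
    (y : Y) : ((Finset.univ.filter fun b : Ctr N M₀ => y ∈ ETor M₀ e b).card : ℝ) ≤ (2 ^ ν : ℕ) := by
  classical
  set x := UT.toSite N (e y) with hx
  choose k₀ k₁ hk using fun i => cdist_two_term hM₀ (hdiv i) (h2N i) (x i)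
  have hsub : (Finset.univ.filter fun b : Ctr N M₀ => y ∈ ETor M₀ e b)
      ⊆ Fintype.piFinset fun i => ({k₀ i, k₁ i} : Finset (Fin (nC (N i) M₀))) := by
    intro b hb
    rw [Finset.mem_filter] at hb
    have hlt : dist (e y) (ctrU N M₀ b) < M₀ := (mem_ETor e b y).1 hb.2
    rw [Fintype.mem_piFinset]
    intro i
    by_contra hni
    simp only [Finset.mem_insert, Finset.mem_singleton, not_or] at hni
    have hge : (M₀ : ℝ) ≤ cdist (N i) M₀ (b i) (x i) := (hk i).2.2.2 (b i) hni.1 hni.2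
    have hle : cdist (N i) M₀ (b i) (x i) ≤ dist (e y) (ctrU N M₀ b) := by
      rw [← ccoord_ctr_eq (UT.one_le N) M₀ b x i, UT.dist_eq]
      unfold tdist
      exact_mod_cast Finset.le_sup (f := ccoord N x (ctr (UT.one_le N) M₀ b)) (Finset.mem_univ i)
    linarith
  have hcard : (Finset.univ.filter fun b : Ctr N M₀ => y ∈ ETor M₀ e b).card ≤ 2 ^ ν := by
    refine (Finset.card_le_card hsub).trans ?_
    rw [Fintype.card_piFinset]
    calc ∏ i, ({k₀ i, k₁ i} : Finset (Fin (nC (N i) M₀))).card ≤ ∏ _i : Fin ν, 2 :=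
          Finset.prod_le_prod' fun i _ => Finset.card_le_two
      _ = 2 ^ ν := by simp
  exact_mod_cast hcard

omit [DecidableEq Y] in
/-- **`hdiam`**: `□̃_b` has `tdistOn`-diameter `≤ 2M₀` (in fact `< 2M₀`). [folklore] -/
theorem diam_ETor_le (M₀ : ℕ) (e : Y → UT N) (b : Ctr N M₀) :
    ∀ z ∈ ETor M₀ e b, ∀ z' ∈ ETor M₀ e b, tdistOn e z z' ≤ 2 * (M₀ : ℝ) := by
  intro z hz z' hz'
  have h1 : dist (e z) (ctrU N M₀ b) < M₀ := (mem_ETor e b z).1 hz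
  have h2 : dist (e z') (ctrU N M₀ b) < M₀ := (mem_ETor e b z').1 hz'
  rw [dist_comm] at h2
  calc tdistOn e z z' = dist (e z) (e z') := rfl
    _ ≤ dist (e z) (ctrU N M₀ b) + dist (ctrU N M₀ b) (e z') := dist_triangle _ _ _
    _ ≤ 2 * (M₀ : ℝ) := by linarith

end Partition

/-! ## §3 The decoration cells of the torus and their packing -/

section Cells

/-- The decoration CELL of a site: coordinatewise `⌊x_i∕M_d⌋` of the residue `x_i ∈ [0, N_i)` of `e y`, an element of
`ℤ^ν` (the cell type of the box version). [folklore] -/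
def tcellAt (Md : ℕ) (e : Y → UT N) (y : Y) : Fin ν → ℤ := fun i => ((UT.toSite N (e y) i).val : ℤ) / (Md : ℤ)

/-- **ONE CIRCLE**: if the residue `t` is within circular distance `R` of `a` (`M_d ∣ N`, `2R ≤ M_d`), then `⌊t∕M_d⌋` is one
of the two cells `⌊(a − R)∕M_d⌋`, `⌊(a − R)∕M_d⌋ + 1` read modulo the number of cells `N∕M_d` (the wrap-around handled by
the centred representative of `t − a`). [folklore] -/
theorem ediv_mem_pair_of_circAbs_le {Nn Md R : ℕ} (hMd : 0 < Md) (hdiv : Md ∣ Nn) (hN : 1 ≤ Nn) (h2R : 2 * R ≤ Md)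
    (a t : Fin Nn) (h : circAbs Nn ((a.val : ℤ) - (t.val : ℤ)) ≤ R) :
    (t.val : ℤ) / Md = ((a.val : ℤ) - R) / Md % ((Nn / Md : ℕ) : ℤ) ∨
      (t.val : ℤ) / Md = (((a.val : ℤ) - R) / Md + 1) % ((Nn / Md : ℕ) : ℤ) := by
  set nc : ℕ := Nn / Md with hnc
  have hNnc : (Nn : ℤ) = (Md : ℤ) * (nc : ℤ) := by
    have := Nat.mul_div_cancel' hdiv
    rw [hnc]; exact_mod_cast this.symm
  have hMd' : (Md : ℤ) ≠ 0 := by exact_mod_cast hMd.ne'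
  have hMdpos : (0 : ℤ) < Md := by exact_mod_cast hMd
  have hNpos : (0 : ℤ) < Nn := by exact_mod_cast hN
  have hncpos : (0 : ℤ) < nc := by
    have : 0 < nc := Nat.div_pos (Nat.le_of_dvd (by omega) hdiv) hMd
    exact_mod_cast this
  -- the centred representative `s` of `t − a`: `|s| ≤ R` and `t = (a + s) mod N`
  set s : ℤ := crep Nn ((t.val : ℤ) - (a.val : ℤ)) with hs
  have hsabs : |s| ≤ (R : ℤ) := by
    rw [hs, abs_crep hN, show (t.val : ℤ) - (a.val : ℤ) = -((a.val : ℤ) - (t.val : ℤ)) by ring, circAbs_neg hN]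
    exact h
  have hmod : ((a.val : ℤ) + s) % (Nn : ℤ) = (t.val : ℤ) := by
    have h1 : s % (Nn : ℤ) = ((t.val : ℤ) - (a.val : ℤ)) % (Nn : ℤ) := crep_emod Nn _
    have h2 : ((a.val : ℤ) + s) % (Nn : ℤ) = ((a.val : ℤ) + ((t.val : ℤ) - (a.val : ℤ))) % (Nn : ℤ) :=
      (Int.ModEq.add_left (a.val : ℤ) h1)
    rw [h2, add_sub_cancel, Int.emod_eq_of_lt (by positivity) (by exact_mod_cast t.isLt)]
  set u : ℤ := (a.val : ℤ) + s with hu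
  -- `t/M_d = (u/M_d) mod nc`
  have htu : (t.val : ℤ) / Md = u / Md % (nc : ℤ) := by
    have hdef : (t.val : ℤ) = u - (Nn : ℤ) * (u / Nn) := by rw [← hmod, Int.emod_def]
    have h1 : (t.val : ℤ) / Md = u / Md + -((nc : ℤ) * (u / Nn)) := by
      rw [hdef, hNnc, show u - (Md : ℤ) * (nc : ℤ) * (u / ((Md : ℤ) * nc)) =
        u + (Md : ℤ) * (-((nc : ℤ) * (u / ((Md : ℤ) * nc)))) by ring, Int.add_mul_ediv_left _ _ hMd']
    have h2 : (t.val : ℤ) / Md % (nc : ℤ) = u / Md % (nc : ℤ) := by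
      rw [h1, show u / Md + -((nc : ℤ) * (u / Nn)) = u / Md + (nc : ℤ) * (-(u / Nn)) by ring,
        Int.add_mul_emod_self_left]
    have h3 : (t.val : ℤ) / Md % (nc : ℤ) = (t.val : ℤ) / Md := by
      refine Int.emod_eq_of_lt (Int.ediv_nonneg (by positivity) hMdpos.le) ?_
      rw [Int.ediv_lt_iff_lt_mul hMdpos]
      calc (t.val : ℤ) < Nn := by exact_mod_cast t.isLt
        _ = (nc : ℤ) * Md := by rw [hNnc, mul_comm]
    rw [← h3, h2]
  -- `u/M_d ∈ {m₀, m₀ + 1}`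
  set m₀ : ℤ := ((a.val : ℤ) - R) / Md with hm₀
  have hlo : m₀ ≤ u / Md := Int.ediv_le_ediv hMdpos (by rw [hu]; linarith [(abs_le.1 hsabs).1])
  have hhi : u / Md ≤ m₀ + 1 := by
    have h1 : u ≤ (a.val : ℤ) - R + (Md : ℤ) * 1 := by
      have h2R' : (2 : ℤ) * R ≤ Md := by exact_mod_cast h2R
      rw [hu]; have := (abs_le.1 hsabs).2; linarith
    calc u / Md ≤ ((a.val : ℤ) - R + (Md : ℤ) * 1) / Md := Int.ediv_le_ediv hMdpos h1
      _ = m₀ + 1 := by rw [Int.add_mul_ediv_left _ _ hMd']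
  rcases (show u / Md = m₀ ∨ u / Md = m₀ + 1 by omega) with h | h
  · left; rw [htu, h]
  · right; rw [htu, h]

omit [Fintype Y] [DecidableEq Y] in
/-- **PACKING ON THE TORUS**: for sites `e : Y → UT N` with `M_d ∣ N_i` and `2R ≤ M_d`, every `tdistOn`-ball of radius `R`
meets at most `2^ν` decoration cells — the `hpack` binder of `UnitLatticeOmegaCells.rowData_decFamilyΩ_cells`.
[cite: Balaban1988RG2Cluster, (1.11) p.5] -/
theorem packing_torus {Md R : ℕ} (hMd : 0 < Md) (hdiv : ∀ i, Md ∣ N i) (h2R : 2 * R ≤ Md) (e : Y → UT N) (a : Y) :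
    ∃ S : Finset (Fin ν → ℤ), S.card ≤ 2 ^ ν ∧ ∀ z : Y, tdistOn e a z ≤ R → tcellAt Md e z ∈ S := by
  classical
  set x := UT.toSite N (e a) with hx
  set m₀ : Fin ν → ℤ := fun i => (((x i).val : ℤ) - R) / Md with hm₀
  refine ⟨Fintype.piFinset fun i =>
      ({m₀ i % ((N i / Md : ℕ) : ℤ), (m₀ i + 1) % ((N i / Md : ℕ) : ℤ)} : Finset ℤ), ?_, fun z hz => ?_⟩
  · rw [Fintype.card_piFinset]
    calc ∏ i, ({m₀ i % ((N i / Md : ℕ) : ℤ), (m₀ i + 1) % ((N i / Md : ℕ) : ℤ)} : Finset ℤ).card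
        ≤ ∏ _i : Fin ν, 2 := Finset.prod_le_prod' fun i _ => Finset.card_le_two
      _ = 2 ^ ν := by simp
  · rw [Fintype.mem_piFinset]
    intro i
    have h1 : (circAbs (N i) (((x i).val : ℤ) - ((UT.toSite N (e z) i).val : ℤ)) : ℝ) ≤ R :=
      (circAbs_le_tdistOn e a z i).trans hz
    have h2 : circAbs (N i) (((x i).val : ℤ) - ((UT.toSite N (e z) i).val : ℤ)) ≤ R := by exact_mod_cast h1
    rcases ediv_mem_pair_of_circAbs_le hMd (hdiv i) (UT.one_le N i) h2R (x i) (UT.toSite N (e z) i) h2 with h | h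
    · exact Finset.mem_insert.2 (Or.inl (by rw [tcellAt, h]))
    · exact Finset.mem_insert_of_mem (Finset.mem_singleton.2 (by rw [tcellAt, h]))

end Cells

/-! ## §4 The lattice profiles on the torus (volume-free numbers for injective sites) -/

section Profiles

omit [DecidableEq Y] in
/-- **ZEROTH PROFILE**: for INJECTIVE `e` and `a > 0`, `Σ_j e^{−a·tdistOn e i j} ≤ (2(1 − e^{−a∕ν})⁻¹)^ν` — the same
closed form as the box's `UnitLatticeProfiles.profile_zero_le`, uniformly in the torus (b04 `torusSum_le`). [folklore] -/
theorem tprofile_zero_le (e : Y → UT N) (he : Function.Injective e) {a : ℝ} (ha : 0 < a) (i : Y) :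
    ∑ j, Real.exp (-(a * tdistOn e i j)) ≤ (2 * (1 - Real.exp (-(a / ν)))⁻¹) ^ ν := by
  classical
  calc ∑ j, Real.exp (-(a * tdistOn e i j))
      = ∑ x ∈ Finset.univ.image e, Real.exp (-(a * dist (e i) x)) := by
        rw [Finset.sum_image fun y _ y' _ h => he h]; rfl
    _ ≤ ∑ x : UT N, Real.exp (-(a * dist (e i) x)) :=
        Finset.sum_le_univ_sum_of_nonneg fun _ => (Real.exp_pos _).le
    _ = ∑ x : TSite ν N, Real.exp (-(a * tdist N (UT.toSite N (e i)) x)) := rfl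
    _ ≤ B4Sect5Proof.latticeConst ν a := torusSum_le ν (UT.one_le N) ha _
    _ = (2 * (1 - Real.exp (-(a / ν)))⁻¹) ^ ν := rfl

omit [DecidableEq Y] in
/-- **FIRST PROFILE**: for INJECTIVE `e` and `0 < b < a`,
`Σ_j tdistOn e i j · e^{−a·tdistOn e i j} ≤ (e·b)⁻¹·(2(1 − e^{−(a−b)∕ν})⁻¹)^ν`. [folklore] -/
theorem tprofile_one_le (e : Y → UT N) (he : Function.Injective e) {a b : ℝ} (hb : 0 < b) (hab : b < a) (i : Y) :
    ∑ j, tdistOn e i j * Real.exp (-(a * tdistOn e i j))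
      ≤ (Real.exp 1 * b)⁻¹ * (2 * (1 - Real.exp (-((a - b) / ν)))⁻¹) ^ ν := by
  have hterm : ∀ j, tdistOn e i j * Real.exp (-(a * tdistOn e i j))
      ≤ (Real.exp 1 * b)⁻¹ * Real.exp (-((a - b) * tdistOn e i j)) := by
    intro j
    have h1 : tdistOn e i j ≤ Real.exp (b * tdistOn e i j) / (Real.exp 1 * b) := le_exp_mul_div hb
    calc tdistOn e i j * Real.exp (-(a * tdistOn e i j))
        ≤ Real.exp (b * tdistOn e i j) / (Real.exp 1 * b) * Real.exp (-(a * tdistOn e i j)) :=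
          mul_le_mul_of_nonneg_right h1 (Real.exp_pos _).le
      _ = (Real.exp 1 * b)⁻¹ * (Real.exp (b * tdistOn e i j) * Real.exp (-(a * tdistOn e i j))) := by
          rw [div_eq_mul_inv]; ring
      _ = (Real.exp 1 * b)⁻¹ * Real.exp (-((a - b) * tdistOn e i j)) := by
          rw [← Real.exp_add]; ring_nf
  calc ∑ j, tdistOn e i j * Real.exp (-(a * tdistOn e i j))
      ≤ ∑ j, (Real.exp 1 * b)⁻¹ * Real.exp (-((a - b) * tdistOn e i j)) := Finset.sum_le_sum fun j _ => hterm j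
    _ = (Real.exp 1 * b)⁻¹ * ∑ j, Real.exp (-((a - b) * tdistOn e i j)) := by rw [Finset.mul_sum]
    _ ≤ (Real.exp 1 * b)⁻¹ * (2 * (1 - Real.exp (-((a - b) / ν)))⁻¹) ^ ν :=
        mul_le_mul_of_nonneg_left (tprofile_zero_le e he (sub_pos.2 hab) i) (by positivity)

end Profiles

/-! ## §5 Non-vacuity -/

/-- **NON-VACUITY**: on the circle `ℤ∕8` (`ν = 1`, `N ≡ 8`) with `M₀ = 2` (`2 ∣ 8`, `2·2 ≤ 8`) the partition binders hold —
`Σ_b h_b² = 1` at every site and the overlap is `≤ 2` — and with `M_d = 4`, `R = 2` (`4 ∣ 8`, `2·2 ≤ 4`) every ball of radius `2`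
meets `≤ 2` cells; sites = the torus itself (`e = id`). [folklore] -/
example :
    (∀ y : UT (fun _ : Fin 1 => 8), ∑ b : Ctr (fun _ : Fin 1 => 8) 2, hTor 2 (fun x => x) b y ^ 2 = 1) ∧
    (∀ y : UT (fun _ : Fin 1 => 8),
      ((Finset.univ.filter fun b : Ctr (fun _ : Fin 1 => 8) 2 => y ∈ ETor 2 (fun x => x) b).card : ℝ) ≤ (2 ^ 1 : ℕ)) ∧
    (∀ a : UT (fun _ : Fin 1 => 8), ∃ S : Finset (Fin 1 → ℤ), S.card ≤ 2 ^ 1 ∧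
      ∀ z, tdistOn (fun x => x) a z ≤ (2 : ℕ) → tcellAt 4 (fun x => x) z ∈ S) :=
  ⟨fun y => hTor_sq_sum (by norm_num) (fun _ => by norm_num) (fun _ => by norm_num) _ y,
    fun y => card_ETor_filter_le (by norm_num) (fun _ => by norm_num) (fun _ => by norm_num) _ y,
    fun a => packing_torus (by norm_num) (fun _ => by norm_num) (by norm_num) _ a⟩

end

end Summit.QuantumFields.BalabanUV.Beta.UnitLatticeTorusPartition
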